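import Literature.IUT.HodgeArakelov.LabelClassesOfCuspsCor24iProofs3R
import Literature.IUT.HodgeArakelov.LabelClassesOfCuspsCor24iiAssembly

/-!
# [IUTchII] Cor 2.4 (ii)(iii)′ assembled over the tower↔[IUTchI] §2 agreements — ONE `ℍ`-datum PER `□` (primed twins)

S. Mochizuki, *Inter-universal Teichmüller theory II*, kurims manuscript (Dec. 2020), §2, Corollary 2.4 (ii)(iii), p. 70
l. 23–74, with Remark 2.1.1 (ii) p. 65 (`Γ^▶_X` "contains every vertex of `Γ_X`") and Definition 2.3 (iv) p. 68 (`Γ^{•t}_X`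
"the connected subgraph with no edges whose unique vertex is the vertex determined by `t`") ([IUTchII] Cor 2.4 (ii), kurims
p.70) [claim: Mochizuki2012, status: disputed] (D-0012 claim key; series status DISPUTED — an assembly of kernel-checked
implications between typed statements; every [IUTchI]/[IUTchII] input is a HYPOTHESIS named by the tree's predicates;
nothing printed is asserted).

v3 — RESTORATION.  «v3 restores the generality of abc-iut-w4-d012 g2's p417021, displaced by p417217 (accidental whole-file
overwrite by abc-iut-L6-t19 gen 4, t19 incident report 02:07:30Z; abc-iut-L6-lead §F v1.18i restoration order); statements per
d012's published signature (INBOX 01:58:17Z; semantic restoration — d012's exact bytes are not available to seats); author of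
record of the two statements: abc-iut-w4-d012 g2.»  In particular input (S) is again taken on the TARGET `□`'s own [IUTchI] §2
datum `(AH : W.StableCurveAgreement C DH)`, separate from the Prop. 2.4 (i) datum `(A, Dsc)` of input (A).  PROOF-ONLY repair
companion (abc-iut cell; filed by abc-iut-L6-t19 gen 4, the R-lineage of record for Cor. 2.4 (ii)(iii): `LabelClassesOfCuspsR2`,
`…Cor24iiTorsionProofs`) of abc-iut-w5-d184's `LabelClassesOfCuspsCor24iiAssembly.lean` (p415267).  No definitions; landed
modules are consumed by fully-qualified name and not edited.

WHY (finding F-w4d012-2 of abc-iut-w4-d012, kernel certificate `LabelClassesOfCuspsCor24iProofs3R.lean` p416675).  The landed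
assembly `cor24_ii_iii'_of_agreement` (and `_tri_of_agreement`) binds, through abc-iut-w4-d012's part-3 closer
`cor24_i'_of_agreement`, an `ℍ`-dictionary `Dic : ∀ H', Cor24_family Dec Ld H' → A.SubgraphDictionary H'` for EVERY admissible
`Π_{v□'}` over ONE agreement `A : W.StableCurveAgreement C Dsc`, i.e. ONE [IUTchI] §2 datum `Dsc` whose sub-graph `ℍ` is baked in;
two such dictionaries force `Δ^±_{v□₁} = Δ^±_{v□₂}` (`StableCurveAgreement.deltaPmBox_eq_of_subgraphDictionary`), whereas at the
intended model `Γ^{•t}_X ⊊ Γ^▶_X`, so the hypothesis is jointly UNSATISFIABLE there as soon as the printed family `{▶} ∪ {•t}`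
has two members (`not_forall_subgraphDictionary_of_deltaPmBox_ne`) — the landed theorems are sound proof terms but
uninstantiable at the model.  Print applies "[IUTchI], Corollary 2.3 … with `X = X_v`, `ℍ = Γ_□`" for EACH `□`; abc-iut-w4-d012's
repaired closer `cor24_i'_of_agreements` (p416675) therefore takes ONE [IUTchI] §2 datum and agreement PER admissible `Π_{v□'}`:
`Dic : ∀ H', Cor24_family Dec Ld H' → ∃ (D' : StableCurveTemperedData) (A' : W.StableCurveAgreement C D'),
A'.SubgraphDictionary H' ∧ D'.Cor23ii ∧ D'.Cor23v`.  This file is the corresponding PRIMED TWIN of the (ii)(iii) assembly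
(R-convention of the cell; the old names stay in the tree, superseded in use):

* `cor24_ii_iii'_of_agreements` — `Cor24_ii_iii' W C H` for an admissible `Π_{v□}` from: an agreement `A` over a datum `Dsc`
  with [IUTchI] Prop. 2.4 (i) `Dsc.Prop24i` and the Rmk. 2.4.1 datum `hΛ` (input (A) — about `X_v` only); an agreement `AH` over
  the TARGET `□`'s own datum `DH` ("`X = X_v`, `ℍ = Γ_□`") with the `Π`-level dictionary entry `hBox` for `Π_{v□}` and [IUTchI]
  Cor. 2.3 (iii) `DH.Cor23iii` under `DH.Cor23Hyp` (input (S), `StableCurveAgreement.boxOntoGalois_of_cor23iii`, p414090); the PER-`□'` data `Dic` (input (C) of Cor. 2.4 (i) for every member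
  of the family); the open-subgroup step (B) `h23vi` (GAP-LEDGER G-w4d012-2; reduced to per-level statements by
  `PlusMinusTower.h23vi_of_levelwise` / `h23vi_of_levelData`, p414651 / p416078); input (E) `hcap`; sub-node (a.2) `hYdd`.
  ALL HYPOTHESES.  PROVED: `cor24_ii_iii'_of_inputs` ∘ `cor24_i'_of_agreements` ∘ `boxOntoGalois_of_cor23iii`.
* `cor24_ii_iii'_tri_of_agreements` — the case `□ = ▶` with (E) supplied BY NAME from abc-iut-L6-t1's `Def23_i_indices`.
* (bookkeeping, in a comment: the landed single-datum form is the special case `D' := Dsc, A' := A` of the primed one.)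

Compared with p415267 the hypotheses `h23ii : Dsc.Cor23ii`, `h23vD : Dsc.Cor23v` disappear from the top level (they now live,
per `□'`, inside `Dic`).  Nothing here takes a side on [IUTchIII] Cor. 3.12; typed ≠ discharged for the named inputs.
-/

namespace Literature.IUT.HodgeArakelov

open Literature.IUT.HodgeTheaters Literature.AnabelianGeometry.SemiGraphs

universe u

variable {S : BadPlaceSetting.{u}} {P : TopGroup.{u}} {T : TemperedCoverings S P}
  {D : EtaleThetaData S.toThetaSetting P} {Dsc : StableCurveTemperedData.{u}}
  (Dec : SubgraphDecomposition S T D) (W : PlusMinusTower T) (C : CuspidalInertiaData W)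
  {L : LabCuspStructure C} (Ld : LabelledDecomposition Dec L) (H : Subgroup P)

/-- **IUTchII:Cor2.4(ii)(iii)′ — node-level closing theorem over the agreements, ONE [IUTchI] §2 datum PER admissible
`Π_{v□'}`** (kurims p. 70; primed twin of abc-iut-w5-d184's `cor24_ii_iii'_of_agreement`, repairing F-w4d012-2; statement =
abc-iut-w4-d012 g2's p417021, restored).  For an admissible `Π_{v□}` (`Cor24_family`: `□ ∈ {•t, ▶}`), the statement of record
`Cor24_ii_iii' W C H` (abc-iut-L6-d1) follows from: abc-iut-L6-t7's agreements (B13) `A` over a datum `Dsc` carrying [IUTchI]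
Prop. 2.4 (i) (`Dsc.Prop24i`) and `AH` over the target-`□` datum `DH` carrying the `Π`-level entry `hBox` for `Π_{v□}` and
[IUTchI] Cor. 2.3 (iii) (`DH.Cor23iii` under `DH.Cor23Hyp`); for EVERY
admissible `Π_{v□'}` SOME [IUTchI] §2 datum `D'` ("`X = X_v`, `ℍ = Γ_{□'}`") with an agreement `A'`, its `ℍ`-dictionary and
Cor. 2.3 (ii), (v) (`Dic`); the Rmk. 2.4.1 datum `hΛ`; the open-subgroup step (B) `h23vi` (GAP-LEDGER G-w4d012-2); input (E)
`hcap` (Def. 2.3 (i)/(iv)); and sub-node (a.2) `hYdd` ("the cusps of `X̲_v` split completely in `Ÿ̲_v`") — ALL HYPOTHESES,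
never asserted.  PROVED (composition of `cor24_ii_iii'_of_inputs`, `cor24_i'_of_agreements`,
`StableCurveAgreement.boxOntoGalois_of_cor23iii`). ([IUTchII] Cor 2.4 (ii) p.70) [claim: Mochizuki2012, status: disputed] -/
theorem cor24_ii_iii'_of_agreements (hH : Cor24_family Dec Ld H) (A : W.StableCurveAgreement C Dsc)
    (h24i : Dsc.Prop24i)
    (hΛ : ∀ I : Subgroup W.Corhat, C.IsCuspidalInertia W.piV I →
      ∃ Λ : Subgroup Dsc.DeltaTp, IsCompact (Λ : Set Dsc.DeltaTp) ∧ Λ ≠ ⊥ ∧ IsProSigma Dsc.graph.Sigma Λ ∧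
        (Λ.map Dsc.DeltaTp.subtype).map Dsc.ιX ≤ (I.subgroupOf W.pmHat).map A.eHat.toMonoidHom)
    (Dic : ∀ H' : Subgroup P, Cor24_family Dec Ld H' →
      ∃ (D' : StableCurveTemperedData.{u}) (A' : W.StableCurveAgreement C D'),
        A'.SubgraphDictionary H' ∧ D'.Cor23ii ∧ D'.Cor23v)
    {DH : StableCurveTemperedData.{u}} (AH : W.StableCurveAgreement C DH) (hHyp : DH.Cor23Hyp)
    (h23iii : DH.Cor23iii)
    (hBox : ((W.pmBox H).subgroupOf W.pmHat).map AH.eHat.toMonoidHom = DH.piTpXH.map DH.ιX)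
    (h23vi : ∀ I : Subgroup W.Corhat, C.IsCuspidalInertia W.piV I → ∀ H' : Subgroup P, Cor24_family Dec Ld H' →
      ∀ γ' : W.Corhat, γ' ∈ W.piPM ⊓ W.aug.ker →
        I.map (MulAut.conj γ').toMonoidHom ≤ W.pmBox H' → γ' ∈ closure (W.deltaPmBox H' : Set W.Corhat))
    (hcap : W.pmBox H ⊓ W.piV ≤ W.box H)
    (hYdd : ∀ I : Subgroup W.Corhat, C.IsCuspidalInertia W.piV I → I ≤ W.deltaBox H →
      W.cuspDecomp I 1 ≤ (T.YddL).map (W.emb.comp T.incl)) :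
    Literature.IUT.HodgeArakelov.Cor24_ii_iii' W C H :=
  cor24_ii_iii'_of_inputs
    (fun I hI hIΔ =>
      cor24_i'_of_agreements Dec W C Ld I A h24i (hIΔ.trans inf_le_right) (hΛ I hI) Dic (h23vi I hI) H hH)
    (AH.boxOntoGalois_of_cor23iii hBox hHyp h23iii) hcap hYdd

/-- **IUTchII:Cor2.4(ii)(iii)′ for `□ = ▶` over the agreements, with (E) BY NAME** (kurims p. 70; primed twin of
`cor24_ii_iii'_tri_of_agreement`): as `cor24_ii_iii'_of_agreements` at `Π_{v▶} = Dec.Ptri`, input (E) being the first conjunct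
of abc-iut-L6-t1's typed Def. 2.3 (i) predicate `Def23_i_indices Dec W`.  PROVED (modulo the named inputs).
([IUTchII] Cor 2.4 (ii) p.70) [claim: Mochizuki2012, status: disputed] -/
theorem cor24_ii_iii'_tri_of_agreements (A : W.StableCurveAgreement C Dsc) (hDef : Def23_i_indices Dec W)
    (h24i : Dsc.Prop24i)
    (hΛ : ∀ I : Subgroup W.Corhat, C.IsCuspidalInertia W.piV I →
      ∃ Λ : Subgroup Dsc.DeltaTp, IsCompact (Λ : Set Dsc.DeltaTp) ∧ Λ ≠ ⊥ ∧ IsProSigma Dsc.graph.Sigma Λ ∧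
        (Λ.map Dsc.DeltaTp.subtype).map Dsc.ιX ≤ (I.subgroupOf W.pmHat).map A.eHat.toMonoidHom)
    (Dic : ∀ H' : Subgroup P, Cor24_family Dec Ld H' →
      ∃ (D' : StableCurveTemperedData.{u}) (A' : W.StableCurveAgreement C D'),
        A'.SubgraphDictionary H' ∧ D'.Cor23ii ∧ D'.Cor23v)
    {DH : StableCurveTemperedData.{u}} (AH : W.StableCurveAgreement C DH) (hHyp : DH.Cor23Hyp)
    (h23iii : DH.Cor23iii)
    (hBox : ((W.pmBox Dec.Ptri).subgroupOf W.pmHat).map AH.eHat.toMonoidHom = DH.piTpXH.map DH.ιX)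
    (h23vi : ∀ I : Subgroup W.Corhat, C.IsCuspidalInertia W.piV I → ∀ H' : Subgroup P, Cor24_family Dec Ld H' →
      ∀ γ' : W.Corhat, γ' ∈ W.piPM ⊓ W.aug.ker →
        I.map (MulAut.conj γ').toMonoidHom ≤ W.pmBox H' → γ' ∈ closure (W.deltaPmBox H' : Set W.Corhat))
    (hYdd : ∀ I : Subgroup W.Corhat, C.IsCuspidalInertia W.piV I → I ≤ W.deltaBox Dec.Ptri →
      W.cuspDecomp I 1 ≤ (T.YddL).map (W.emb.comp T.incl)) :
    Literature.IUT.HodgeArakelov.Cor24_ii_iii' W C Dec.Ptri :=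
  cor24_ii_iii'_of_agreements Dec W C Ld Dec.Ptri (cor24_family_tri Dec W C Ld) A h24i hΛ Dic AH hHyp h23iii hBox
    h23vi (W.pmBox_inf_piV_le_box_of_def23_i_indices Dec hDef (Or.inr rfl)) hYdd

/-! Bookkeeping (not re-declared — it would restate the landed theorem): the landed SINGLE-datum form
`cor24_ii_iii'_of_agreement` (p415267) is the special case of `cor24_ii_iii'_of_agreements` obtained with
`Dic := fun H' hH' => ⟨Dsc, A, Dic₀ H' hH', h23ii, h23vD⟩`; so nothing provable was lost in the repair, while by
`not_forall_subgraphDictionary_of_deltaPmBox_ne` (p416675) the single-datum binder `Dic₀` has no instance at the model once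
the family has two members with distinct `Δ^±_{v□}`. -/

end Literature.IUT.HodgeArakelov
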